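import Summits.QuantumFields.YangMills.Theorems.BalabanUVNodesN21DilationTransversal

/-!
# N21 (NE7c) · the transversal dilation road's SLOT FIELD: per slot, `LevelLedger.slot` with the level constant
# `((1+Q)∕κ)·3(d+1)∕(1−ρ)` — the shape part 19 §E's END consumes

R134 seat pub-ymgap-dag-n21-d (g8), node N21 = NE7c (single-run shell-weight bound, NOT PRINTED in [Bałaban 1983–89],
NOT proved), lane K3⁷ `SpineGivenEndpointR13SepCoPH` (stmt-QuantumFields-20544, `--kind proof --supports … --as helper`).
Part 26 of the comparison series; consumes part 19 (`…N21DilationTransversal`, lens Card 69 landed) and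
`T4ShellMeasure.slot_field_of_antiConcentration`.

WHAT THIS FILE IS.  Part 16 §4 gave the `LevelLedger.slot` inequality for a HOMOGENEOUS slot statistic; part 19 (the
one-centre version: radial transversality `κ`, cut `C`, envelope odds `Q`) stopped at `SlotAntiConcentration`.  This
file closes that gap BY NAME: `slot_field_of_radialTransversal` — with the dictionary binders of
`T4ShellMeasure.slot_field_of_antiConcentration` (pieces `≤ M₀ ×` the shell mass of the cut fibre law `ν|({U<θ} ∩ C)`,
`M₀ ×` its total mass `≤` the term weights), the per-slot inequality
`Σ piece ≤ (3(d+1)(1+Q)∕(κ(1−ρ)) · ρ) · Σ A`, and `dilationConst_transversal_eq`: that constant IS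
`((1+Q)∕κ) · (3(d+1)∕(1−ρ))` — the level-constant shape `M · 3(d_j+1)∕(1−ρ_j)` of part 19 §E's
`shellWeightBound_of_levels_dilation_const` with `M = (1+Q)∕κ`.

HONEST FRAMING.  [folklore] bookkeeping; 0 def, 0 sorry; every located input (radial monotonicity about the background,
radial transversality `κ`, envelope∕odds `Q`, the dictionary binders) stays a displayed hypothesis; nothing of
Bałaban's asserted; NE7c NOT PRINTED ∕ NOT proved; N21 NOT discharged; counts unmoved (typed 28∕28 · discharged
5∕27); count-neutral; one finite 𝕋⁴ at fixed ε — nothing about ℝ⁴ ∕ OS ∕ mass gap ∕ Clay.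
-/

open MeasureTheory Set Function Module
open scoped ENNReal NNReal Pointwise

namespace Summit.QuantumFields.YangMills.Theorems.N21DilationTransversalSlotField

open Literature.MathematicalPhysics.QuantumFieldTheory.Balaban1983to89.T4ShellMeasure
  (SlotAntiConcentration slot_field_of_antiConcentration)
open Summit.QuantumFields.YangMills.Theorems.N21DilationTransversal
  (slotAntiConcentration_restrict_of_radialTransversal)

variable {ι : Type*} [Fintype ι]

/-- the transversal road's constant is the dilation constant times `(1+Q)∕κ`. [folklore] -/
theorem dilationConst_transversal_eq (d Q κ ρ : ℝ) :
    3 * (d + 1) * (1 + Q) / (κ * (1 - ρ)) = ((1 + Q) / κ) * (3 * (d + 1) / (1 - ρ)) := by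
  rw [div_mul_div_comm]
  ring_nf

/-- **THE `LevelLedger.slot` FIELD ON THE TRANSVERSAL DILATION ROAD.**  Under the hypotheses of part 19's
`slotAntiConcentration_restrict_of_radialTransversal` (radial monotonicity of the action about the background on the
shell ∩ `C`, radial transversality `κ`, envelope `Env` with odds `Q`), a finite fibre law, and the dictionary binders
(pieces `≤ M₀ ×` shell mass of the cut law `μ = ν|({U<θ} ∩ C)`, `M₀ · μ(univ) ≤ Σ A`):
`Σ_τ piece τ ≤ (((1+Q)∕κ) · (3(d+1)∕(1−ρ)) · ρ) · Σ_τ A τ`. [folklore] -/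
theorem slot_field_of_radialTransversal [Nonempty ι] {A : (ι → ℝ) → ℝ} (hA : Measurable A)
    [IsFiniteMeasure (volume.withDensity fun x : ι → ℝ => ENNReal.ofReal (Real.exp (-A x)))]
    {U : (ι → ℝ) → ℝ} (hUm : Measurable U) {C Env : Set (ι → ℝ)} (hC : MeasurableSet C)
    (hEnv : MeasurableSet Env) {θ ρ κ Q : ℝ} (hθ : 0 < θ) (hρ0 : 0 < ρ) (hρ1 : ρ < 1) (hκ : 0 < κ) (hQ0 : 0 ≤ Q)
    (henv : ∀ l ∈ Icc (1 - 1 / ((Fintype.card ι : ℝ) + 1)) 1, ∀ z,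
      θ * (1 - ρ) ≤ U z → U z < θ → z ∈ C → l • z ∈ Env)
    (hmono : ∀ l ∈ Icc (1 - 1 / ((Fintype.card ι : ℝ) + 1)) 1, ∀ z,
      θ * (1 - ρ) ≤ U z → U z < θ → z ∈ C → A (l • z) ≤ A z)
    (hRT : ∀ z, θ * (1 - ρ) ≤ U z → U z < θ → z ∈ C → ∀ s : ℝ, 1 ≤ s →
      θ * (1 - ρ) ≤ U (s • z) → U (s • z) < θ → s • z ∈ C →
        U z + κ * (θ * (1 - ρ)) * (s - 1) ≤ U (s • z))
    (hQ : (volume.withDensity fun x => ENNReal.ofReal (Real.exp (-A x))) (Env \ ({x | U x < θ} ∩ C))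
      ≤ ENNReal.ofReal Q *
        (volume.withDensity fun x => ENNReal.ofReal (Real.exp (-A x))) ({x | U x < θ} ∩ C))
    {τ : Type*} (T : Finset τ) {piece Aw : τ → ℝ} {M₀ : ℝ} (hM₀ : 0 ≤ M₀)
    (hpiece : ∑ t ∈ T, piece t ≤ M₀ *
      (((volume.withDensity fun x : ι → ℝ => ENNReal.ofReal (Real.exp (-A x))).restrict ({x | U x < θ} ∩ C))
        {x | θ * (1 - ρ) ≤ U x ∧ U x < θ}).toReal)
    (hAw : M₀ * (((volume.withDensity fun x : ι → ℝ => ENNReal.ofReal (Real.exp (-A x))).restrict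
        ({x | U x < θ} ∩ C)) univ).toReal ≤ ∑ t ∈ T, Aw t) :
    ∑ t ∈ T, piece t ≤ (((1 + Q) / κ) * (3 * ((Fintype.card ι : ℝ) + 1) / (1 - ρ)) * ρ) * ∑ t ∈ T, Aw t := by
  have h := slotAntiConcentration_restrict_of_radialTransversal hA hUm hC hEnv hθ hρ0 hρ1 hκ hQ0 henv hmono hRT hQ
  rw [dilationConst_transversal_eq] at h
  have hD : 0 ≤ ((1 + Q) / κ) * (3 * ((Fintype.card ι : ℝ) + 1) / (1 - ρ)) := by
    have : (0 : ℝ) < 1 - ρ := by linarith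
    positivity
  exact slot_field_of_antiConcentration hD hρ0.le h T hM₀ hpiece hAw

end Summit.QuantumFields.YangMills.Theorems.N21DilationTransversalSlotField
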